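import Mathlib.Analysis.Complex.Polynomial.Basic
import Mathlib.FieldTheory.AbsoluteGaloisGroup
import Mathlib.NumberTheory.NumberField.Basic
import Literature.GroupTheory.PermutationGroups.SmallIndexSubgroupsAlternating
import HarnessLib

/-!
# Rational polynomials with symmetric Galois group stay non-solvable over every number field
# of small degree

Topic `Literature/NumberTheory/NumberFields` (finite Galois theory of number fields).
Theorem-only file (no definition, no named fact), classical, Mathlib vocabulary only
(`Polynomial.Gal`, `Polynomial.Gal.galActionHom`, `IsSolvable`, `Field.absoluteGaloisGroup`).

Let `f ∈ ℚ[X]` be irreducible of degree `n ≥ 5` whose Galois group is the full symmetric group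
on its complex roots (`Function.Bijective (Polynomial.Gal.galActionHom f ℂ)`, the conclusion of
Mathlib's `Polynomial.Gal.galActionHom_bijective_of_prime_degree`).  If `F` is a number field
with `[F : ℚ] < n`, then the Galois group over `F` of `f` (i.e. of the splitting field of `f`
over `F`) is NOT solvable (`not_isSolvable_gal_map_of_galActionHom_bijective`).

Proof (the classical "translation" argument, done by counting instead of by the Galois
correspondence).  Let `E/F` be a splitting field of `f` over `F`; it contains a splitting field
`K/ℚ` of `f`, and restriction gives an injective homomorphism `Gal(E/F) → Gal(K/ℚ) ≅ Sₙ`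
(injective because `E` is generated over `F` by the roots).  Its image `H` has index
`[K : ℚ] / [E : F] ≤ [E : ℚ] / [E : F] = [F : ℚ] < n`.  A subgroup of `Sₙ` (`n ≥ 5`) of index
`< n` contains `Aₙ` (Jordan's bound, the tree's
`Literature.GroupTheory.PermutationGroups.alternatingGroup_subgroup_eq_top_of_index_lt_card`),
hence is not solvable (`not_isSolvable_of_index_lt_card`); so `Gal(E/F) ≅ H` is not solvable.

Consequences recorded for consumers: a polynomial over `F` with non-solvable Galois group makes
the absolute Galois group `Gal(F̄/F)` non-solvable as an abstract group
(`absoluteGaloisGroup_not_isSolvable_of_gal`), i.e. `F̄ ≠ F^{sol}`; the existence of such `f`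
for every prime degree `p ≥ 5` is the companion file `PrimeDegreeSymmetricGalois.lean`, and the
unconditional statement "the absolute Galois group of a number field is not (pro)solvable" is
assembled in `AbsoluteGaloisGroupNotSolvable.lean`.

## References

* N. Jacobson, *Basic Algebra I*, 2nd ed. (1985), §4.10 (Galois group of an irreducible
  polynomial of prime degree with exactly two non-real roots is `S_p`; existence for every `p`).
* J. J. Rotman, *An Introduction to the Theory of Groups*, 4th ed. (1995), Thm 3.11, Cor 3.15
  (subgroups of index `< n` in `Aₙ`).
* S. Lang, *Algebra*, rev. 3rd ed. (2002), Ch. VI, Thm 1.12 (Galois group of a compositum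
  `EL/L` is `Gal(E/E ∩ L)`).
-/

namespace Literature.NumberTheory.NumberFields

open Polynomial

/-! ### §1. Subgroups of small index in a symmetric group are not solvable -/

/-- **Small-index subgroups of `Sₙ` are insoluble.**  If `|α| ≥ 5` and `H ≤ Sym(α)` has index
`< |α|`, then `H` is not solvable: `H ∩ Alt(α)` has index `< |α|` in `Alt(α)`, so equals `Alt(α)`
by Jordan's bound (tree: `alternatingGroup_subgroup_eq_top_of_index_lt_card`); a solvable `H`
would make `Alt(α)` and then `Sym(α) = Alt(α).C₂` solvable, contradicting Mathlib's
`Equiv.Perm.not_solvable`. [cite: Rotman1995, Thm 3.11, Cor 3.15] -/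
theorem not_isSolvable_of_index_lt_card {α : Type*} [Fintype α] [DecidableEq α]
    (h5 : 5 ≤ Fintype.card α) (H : Subgroup (Equiv.Perm α)) (hH : H.index < Fintype.card α) :
    ¬ IsSolvable H := by
  classical
  intro hsolv
  set A := alternatingGroup α with hA
  -- `H ∩ A`, as a subgroup of `A`, has index `≤ [Sym : H] < |α|`
  have hrel : (H.subgroupOf A).index < Fintype.card α := by
    have h1 : H.relIndex A ≤ H.relIndex ⊤ :=
      Subgroup.relIndex_le_of_le_right le_top
        (by rw [Subgroup.relIndex_top_right]; exact Subgroup.index_ne_zero_of_finite)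
    rw [Subgroup.relIndex_top_right] at h1
    exact lt_of_le_of_lt h1 hH
  have htop : H.subgroupOf A = ⊤ :=
    Literature.GroupTheory.PermutationGroups.alternatingGroup_subgroup_eq_top_of_index_lt_card
      h5 _ hrel
  have hAH : A ≤ H := Subgroup.subgroupOf_eq_top.mp htop
  -- hence `A` is solvable, hence `Sym(α)` is solvable (extension of `C₂` by `A`)
  haveI : IsSolvable A := solvable_of_solvable_injective (Subgroup.inclusion_injective hAH)
  have hS : IsSolvable (Equiv.Perm α) := by
    refine solvable_of_ker_le_range A.subtype (Equiv.Perm.sign (α := α)) ?_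
    intro σ hσ
    exact ⟨⟨σ, by rw [hA]; exact hσ⟩, rfl⟩
  refine Equiv.Perm.not_solvable α ?_ hS
  rw [Cardinal.mk_fintype]
  exact_mod_cast h5

/-! ### §2. Transfer from `ℚ` to a number field of small degree -/

section Transfer

variable (F : Type*) [Field F] [NumberField F]

/-- Roots of `f ∈ ℚ[X]` in an `F`-algebra `E` are the roots of its image in `F[X]`.
[folklore] -/
private theorem rootSet_map_algebraMap_eq {E : Type*} [Field E] [Algebra F E] [Algebra ℚ E]
    [IsScalarTower ℚ F E] (f : ℚ[X]) :
    (f.map (algebraMap ℚ F)).rootSet E = f.rootSet E := by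
  simp only [rootSet, aroots, Polynomial.map_map, ← IsScalarTower.algebraMap_eq ℚ F E]

/-- **Transfer theorem.**  Let `F` be a number field and `f ∈ ℚ[X]` irreducible of degree
`n ≥ 5` with `[F : ℚ] < n`, whose Galois group over `ℚ` is the full symmetric group on its
complex roots.  Then the Galois group of `f` over `F` (the group of the splitting field over `F`
of the image of `f` in `F[X]`) is not solvable.  Proof: restriction `Gal(E/F) ↪ Gal(f/ℚ) ≅ Sₙ`
is injective with image of index `[K:ℚ]/[E:F] ≤ [F:ℚ] < n`, and subgroups of `Sₙ` of index
`< n` are insoluble (`not_isSolvable_of_index_lt_card`).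
[cite: Jacobson1985, §4.10; Lang2002, Ch. VI Thm 1.12] -/
theorem not_isSolvable_gal_map_of_galActionHom_bijective {f : ℚ[X]} (hirr : Irreducible f)
    (h5 : 5 ≤ f.natDegree) (hdeg : Module.finrank ℚ F < f.natDegree)
    (hbij : letI := @Gal.splits_ℚ_ℂ f; Function.Bijective (Gal.galActionHom f ℂ)) :
    ¬ IsSolvable (f.map (algebraMap ℚ F)).Gal := by
  classical
  letI := @Gal.splits_ℚ_ℂ f
  intro hsolv
  set fF : F[X] := f.map (algebraMap ℚ F) with hfF
  let E := fF.SplittingField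
  have hsepF : fF.Separable := hirr.separable.map
  haveI : IsGalois F E := IsGalois.of_separable_splitting_field hsepF
  haveI : FiniteDimensional ℚ E := Module.Finite.trans F E
  -- `f` splits in `E`
  have hsplitE : (f.map (algebraMap ℚ E)).Splits := by
    rw [IsScalarTower.algebraMap_eq ℚ F E, ← Polynomial.map_map]
    exact SplittingField.splits fF
  haveI hfact : Fact ((f.map (algebraMap ℚ E)).Splits) := ⟨hsplitE⟩
  -- restriction of scalars `Gal(E/F) → Gal(E/ℚ)` as a group homomorphism
  let ψ : Gal(E/F) →* Gal(E/ℚ) :=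
    { toFun := fun σ => σ.restrictScalars ℚ
      map_one' := by ext; rfl
      map_mul' := fun _ _ => by ext; rfl }
  let φ : Gal(E/F) →* f.Gal := (Gal.restrict f E).comp ψ
  -- `φ` is injective: an `F`-automorphism of `E` fixing the roots of `f` is trivial
  have hφ : Function.Injective φ := by
    rw [injective_iff_map_eq_one]
    intro σ hσ
    apply Gal.ext
    intro x hx
    have hx' : x ∈ f.rootSet E := by rwa [rootSet_map_algebraMap_eq F f] at hx
    have key := Gal.galActionHom_restrict f E (ψ σ) ⟨x, hx'⟩
    have hφσ : Gal.restrict f E (ψ σ) = 1 := hσ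
    rw [hφσ, map_one, Equiv.Perm.coe_one, id] at key
    -- `key : x = (ψ σ) x`
    change (x : E) = σ x at key
    show σ x = x
    exact key.symm
  -- index of the image
  set H : Subgroup f.Gal := φ.range with hH
  have hcardG : Nat.card f.Gal = Module.finrank ℚ f.SplittingField :=
    Gal.card_of_separable hirr.separable
  have hcardEF : Nat.card Gal(E/F) = Module.finrank F E := IsGalois.card_aut_eq_finrank F E
  have hcardH : Nat.card H = Nat.card Gal(E/F) :=
    (Nat.card_congr (MonoidHom.ofInjective hφ).toEquiv).symm
  have hKE : Module.finrank ℚ f.SplittingField ≤ Module.finrank ℚ E :=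
    LinearMap.finrank_le_finrank_of_injective
      (f := (SplittingField.lift f hsplitE).toLinearMap) (RingHom.injective _)
  have htower : Module.finrank ℚ F * Module.finrank F E = Module.finrank ℚ E :=
    Module.finrank_mul_finrank ℚ F E
  have hmul : Nat.card H * H.index = Nat.card f.Gal := H.card_mul_index
  have hpos : 0 < Nat.card H := Nat.card_pos
  have hindex : H.index ≤ Module.finrank ℚ F := by
    by_contra hlt
    rw [not_le] at hlt
    have h1 : Nat.card H * (Module.finrank ℚ F + 1) ≤ Nat.card H * H.index :=
      Nat.mul_le_mul_left _ hlt
    have h2 : Nat.card H * H.index ≤ Module.finrank ℚ F * Nat.card H := by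
      rw [hmul, hcardG, hcardH, hcardEF, htower]
      exact hKE
    have h3 := h1.trans h2
    nlinarith
  have hindex' : H.index < f.natDegree := lt_of_le_of_lt hindex hdeg
  -- transport to the symmetric group on the complex roots
  let e : f.Gal ≃* Equiv.Perm (f.rootSet ℂ) := MulEquiv.ofBijective (Gal.galActionHom f ℂ) hbij
  have hcardC : Fintype.card (f.rootSet ℂ) = f.natDegree :=
    card_rootSet_eq_natDegree hirr.separable (IsAlgClosed.splits _)
  set H' : Subgroup (Equiv.Perm (f.rootSet ℂ)) := H.map e.toMonoidHom with hH'
  have hidx' : H'.index = H.index := Subgroup.index_map_of_bijective e.bijective H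
  have hns : ¬ IsSolvable H' :=
    not_isSolvable_of_index_lt_card (by rw [hcardC]; exact h5) H' (by rw [hidx', hcardC]; exact hindex')
  -- but `H' ≅ H` is a quotient of the solvable group `Gal(E/F)`
  haveI : IsSolvable Gal(E/F) := hsolv
  haveI : IsSolvable H := solvable_of_surjective (MonoidHom.rangeRestrict_surjective φ)
  have eH : H ≃* H' := H.equivMapOfInjective e.toMonoidHom e.injective
  exact hns (solvable_of_surjective (f := eH.toMonoidHom) (by exact eH.surjective))

/-- A polynomial over `F` with non-solvable Galois group makes the absolute Galois group
`Gal(F̄/F)` non-solvable (restriction `Gal(F̄/F) ↠ Gal(q)` is surjective, Mathlib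
`Polynomial.Gal.restrict_surjective`; a group with a non-solvable quotient is not solvable).
In particular `F̄ ≠ F^{sol}`: `Gal(F̄/F)` has a finite continuous quotient that is not solvable.
[cite: Lang2002, Ch. VI §1 Thm 1.10; Rotman1995, Thm 5.17] -/
theorem absoluteGaloisGroup_not_isSolvable_of_gal {q : F[X]} (hq : ¬ IsSolvable q.Gal) :
    ¬ IsSolvable (Field.absoluteGaloisGroup F) := by
  intro h
  haveI : IsSolvable Gal(AlgebraicClosure F/F) := h
  haveI : Fact ((q.map (algebraMap F (AlgebraicClosure F))).Splits) := ⟨IsAlgClosed.splits _⟩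
  exact hq (solvable_of_surjective (Gal.restrict_surjective q (AlgebraicClosure F)))

end Transfer

end Literature.NumberTheory.NumberFields
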